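import Summits.BirchSwinnertonDyer.BirchSwinnertonDyer.Theorems.ByReductionTypeAtTwoTorsionEulerCharMultNonsplit
import Summits.BirchSwinnertonDyer.BirchSwinnertonDyer.Theorems.ByReductionTypeAtTwoTorsionEulerCharCasselsCount
import HarnessLib

set_option linter.dupNamespace false -- `…BirchSwinnertonDyer.BirchSwinnertonDyer…` is the cell's nested layout (D-0017)
set_option autoImplicit false

/-!
# Greenberg LNM 1716 Lemma 4.7 WITH RATIONAL `p`-TORSION, part 6: THE UPPER-HALF EULER-CHARACTERISTIC DISPLAY AT A
# NON-SPLIT MULTIPLICATIVE `p` OVER `ℚ`, UNCONDITIONALLY (no hypothesis on `E(ℚ)[p]`) — and at `p = 2`: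
# `ord₂ f_E(0) + 2·ord₂ #E(ℚ)(2) ≥ ord₂ ∏_ℓ c_ℓ + 1 + ord₂ #Sel_{2^∞}(E/ℚ)`

Cell `bsd-2adic` (run/shared/lean/pub/bsd-2adic/), seat `bsd-2adic-tower-1` GEN 31; `--supports stmt-BirchSwinnertonDyer-19922`
(helper for the non-split multiplicative rows of the upper-half crux `MultUpperHalfAtTwo`). THEOREMS ONLY (no definition, no
named fact, no `sorry`); closes no item; nothing booked; BSD is not proved by any of this.

R. Greenberg, *Iwasawa theory for elliptic curves*, LNM 1716 (1999), Thm. 4.1 (p. 102) and §4 pp. 112–113 ("If `E` has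
non-split multiplicative reduction at `v` one can take `l_v = 2` (for any prime `p`)"): `f_E(0) ∼ (∏ l_v)(∏ c_v)·#Sel_E(ℚ)_p
/ #E(ℚ)_p²`. Parts 1–5 (`TorsionEulerChar.*`) prove the «`≥`» HALF of this display WITHOUT the hypothesis `E(ℚ)[p] = 0` of the
tree's earlier kernel theorems (GEN 29/30: `MultEulerChar.*`, `MultTowerNS2LayerZero.twoAdicEulerCharRankZeroNonsplitMult_of_noTwoTorsion`):
Lemma 4.7 with torsion up to Cassels' cokernel at an auxiliary place (parts 1–3c), the assembly with Lemmas 4.2/4.3 and the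
layer-`0` local orders (part 4, hypothesis `hC`), and Cassels' cokernel count `#C_{v₀} ≤ #E(ℚ)[p^∞]` for EVERY prime (part 5).
This file removes `hC`, `S`, `v₀` and the receptacle: for every globally minimal elliptic `W/ℚ`, NON-SPLIT multiplicative at
`p`, the cyclotomic `ℤ_p`-extension `κ` with topological generator `γ`, a dual datum `D` with `char X = (f)` and
`Sel_{p^∞}(E/ℚ)` finite:

  **`f(0) · #E(ℚ)(p)² = e · #Sel_{p^∞}(E/ℚ) · ∏_{v ∈ S} #𝒦_{v,0}[p^∞]`, `e ∈ ℤ_p ∖ {0}`** (`S` = bad ∪ {p}), and at `p = 2`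
  **`f(0) · #E(ℚ)(2)² = e · 2^{ord₂ ∏_ℓ c_ℓ + 1} · #Sel_{2^∞}(E/ℚ)`, `e ≠ 0`** — rational `2`-torsion ALLOWED.

This is the direction of `X5.O1.TwoAdicEulerCharRankZeroNonsplitMult W 0` that the upper-half doors consume (sequel: the
one-sided chain). The unit version (`e ∈ ℤ₂ˣ`) needs Lemma 4.6 on `Γ`-invariants and is NOT claimed.

* `exists_finset_place` — bookkeeping (`S ⊇ {bad} ∪ {v ∣ p}` finite, `v₀ ∉ S`);
* `constantCoeff_mul_sq_eq_nonsplit_rat` — any prime `p`;  **`constantCoeff_mul_sq_eq_two_nonsplit`** — `p = 2`.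

HONEST FRAMING: kernel-checked over tree theorems; one half of a printed display; closes no item; no summit statement is
proved; the Birch–Swinnerton-Dyer conjecture is NOT proved by any of this.

References: [GreenbergLNM1716] Thm. 4.1 (p. 102), §4 pp. 104–108, 112–113, Prop. 4.13 (pp. 121–122).
-/

noncomputable section

open scoped Classical NumberField

open NumberField IsDedekindDomain Field

namespace Summit.BirchSwinnertonDyer.BirchSwinnertonDyer.Theorems.TorsionEulerChar

open Literature.NumberTheory.EllipticCurves Literature.NumberTheory.GaloisRepresentations
  WeierstrassCurve ZpExtension Literature.NumberTheory.EllipticCurves.IwasawaAlgebra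
  Literature.NumberTheory.EllipticCurves.IwasawaDual
  Literature.NumberTheory.EllipticCurves.GreenbergVatsal2000 Literature.NumberTheory.EllipticCurves.GreenbergSelmer

/-- **Bookkeeping over `ℚ`: a finite `S ⊇ {bad} ∪ {v ∣ p}` and an auxiliary place `v₀ ∉ S`** (the bad places are finite,
Silverman VIII.1.3 / tree `eventually_hasGoodReductionAt`; the places above `p` are finite; there are infinitely many primes).
[cite: SilvermanAEC2009, Rem. VIII.1.3] -/
theorem exists_finset_place (W : WeierstrassCurve ℚ) [W.IsElliptic] (p : ℕ) [hp : Fact p.Prime] :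
    ∃ (S : Finset (HeightOneSpectrum (𝓞 ℚ))) (v₀ : HeightOneSpectrum (𝓞 ℚ)),
      (∀ v ∉ S, ((p : ℕ) : 𝓞 ℚ) ∉ v.asIdeal ∧ W.HasGoodReductionAt v) ∧ v₀ ∉ S := by
  have hbadfin : {v : HeightOneSpectrum (𝓞 ℚ) | ¬ W.HasGoodReductionAt v}.Finite := by
    have h := W.eventually_hasGoodReductionAt
    rwa [Filter.eventually_cofinite] at h
  have hp0 : (Ideal.span {((p : ℕ) : 𝓞 ℚ)} : Ideal (𝓞 ℚ)) ≠ 0 := by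
    rw [Ne, Ideal.zero_eq_bot, Ideal.span_singleton_eq_bot]
    exact_mod_cast hp.out.ne_zero
  have hpfin : {v : HeightOneSpectrum (𝓞 ℚ) | ((p : ℕ) : 𝓞 ℚ) ∈ v.asIdeal}.Finite := by
    refine (Ideal.finite_factors hp0).subset fun v hv ↦ ?_
    exact (Ideal.dvd_span_singleton).mpr hv
  haveI : Infinite Nat.Primes := Nat.infinite_setOf_prime.to_subtype
  haveI : Infinite (HeightOneSpectrum (𝓞 ℚ)) :=
    Infinite.of_injective _ Rat.HeightOneSpectrum.primesEquiv.symm.injective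
  obtain ⟨v₀, hv₀⟩ := Infinite.exists_notMem_finset (hbadfin.toFinset ∪ hpfin.toFinset)
  refine ⟨hbadfin.toFinset ∪ hpfin.toFinset, v₀, fun v hv ↦ ⟨fun h ↦ hv ?_, by_contra fun h ↦ hv ?_⟩, hv₀⟩
  · exact Finset.mem_union_right _ (hpfin.mem_toFinset.mpr h)
  · exact Finset.mem_union_left _ (hbadfin.mem_toFinset.mpr h)

/-- **THE UPPER-HALF EULER-CHARACTERISTIC DISPLAY AT A NON-SPLIT MULTIPLICATIVE `p` OVER `ℚ`, NO HYPOTHESIS ON `E(ℚ)[p]`.** For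
`W/ℚ` globally minimal elliptic, non-split multiplicative at `p`, `κ` cyclotomic with topological generator `γ`, `D` a dual datum
with `char X = (f)`, `Sel_{p^∞}(E/ℚ)` finite, and `S ⊇ {bad} ∪ {p}` exactly the finite set off which `E` is good and `v ∤ p`:
`X` is finitely generated `Λ`-torsion and **`f(0) · #E(ℚ)(p)² = e · #Sel_{p^∞}(E/ℚ) · ∏_{v ∈ S} #𝒦_{v,0}[p^∞]` with `e ≠ 0`**
— part 4 with Cassels' cokernel at an auxiliary `v₀ ∉ S` (part 5, `finite_and_natCard_cokernel_le`) as the receptacle.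
[cite: GreenbergLNM1716, Thm. 4.1 (p. 102), §4 pp. 104–108 and 112, Prop. 4.13 (p. 122)] -/
theorem constantCoeff_mul_sq_eq_nonsplit_rat (p : ℕ) [hp : Fact p.Prime] (W : WeierstrassCurve ℚ)
    [W.IsGloballyMinimal] [W.IsElliptic] (hmult : W.HasMultiplicativeReductionAtPrime p)
    (hns : ¬ W.HasSplitMultiplicativeReductionAtPrime p) (κ : ZpExtension ℚ p) (hκ : κ.IsCyclotomic)
    {γ : absoluteGaloisGroup ℚ} (hγ : κ.IsTopGenerator γ) (D : W.SelmerDualData κ γ) [Finite (W.selmerGroupPInfty p)]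
    (S : Finset (HeightOneSpectrum (𝓞 ℚ))) (hS : ∀ v ∉ S, ((p : ℕ) : 𝓞 ℚ) ∉ v.asIdeal ∧ W.HasGoodReductionAt v)
    (v₀ : HeightOneSpectrum (𝓞 ℚ)) (hv₀ : v₀ ∉ S)
    (f : IwasawaAlgebra p) (hf : Module.charIdeal (IwasawaAlgebra p) D.X = Ideal.span {f}) :
    Module.Finite (IwasawaAlgebra p) D.X ∧ Module.IsTorsion (IwasawaAlgebra p) D.X ∧
      ∃ e : ℤ_[p], e ≠ 0 ∧ PowerSeries.constantCoeff f *
          (Nat.card (AddCommGroup.primaryComponent W.toAffine.Point p) : ℤ_[p]) ^ 2 =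
        e * Nat.card (W.selmerGroupPInfty p) * ∏ v ∈ S, Nat.card (W.localTowerKerPrimary κ (v.adicCompletion ℚ) 0) := by
  classical
  -- the receptacle: Cassels' cokernel at `v₀`
  let Pv := discreteH1 (localSubgroup (⊤ : Subgroup (absoluteGaloisGroup ℚ)) (v₀.adicCompletion ℚ))
    (localPoints W (v₀.adicCompletion ℚ))
  let P₀ : AddSubgroup Pv := AddCommGroup.primaryComponent Pv p
  let L : AddSubgroup Pv := AddSubgroup.map (W.localResOver p ⊤ (v₀.adicCompletion ℚ))
    (unramifiedOutside (⊤ : Subgroup (absoluteGaloisGroup ℚ)) (W.geomPrimaryTorsion p) p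
        ((↑S : Set (HeightOneSpectrum (𝓞 ℚ))) ∪ {v₀}) ⊓
      (⨅ v ∈ S, W.localKerOver p ⊤ (v.adicCompletion ℚ)) ⊓
      (⨅ w : InfinitePlace ℚ, W.localKerOver p ⊤ w.Completion))
  obtain ⟨hfin, hC⟩ := finite_and_natCard_cokernel_le W p S hS v₀ hv₀
  haveI : Finite (P₀ ⧸ L.addSubgroupOf P₀) := hfin
  -- the `DecidableEq ℚ` instance inside the group law of `E(ℚ)` (classical in part 5)
  have hdec : (fun a b : ℚ => Classical.propDecidable (a = b)) = instDecidableEqRat := Subsingleton.elim _ _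
  rw [hdec] at hC
  exact constantCoeff_mul_sq_eq_nonsplit_rat_of_defect p W hmult hns κ hκ hγ D S hS v₀ hv₀
    (QuotientAddGroup.mk' (L.addSubgroupOf P₀)) (fun z ↦ by
      rw [QuotientAddGroup.mk'_apply, QuotientAddGroup.eq_zero_iff, AddSubgroup.mem_addSubgroupOf]) hC f hf

/-- **`p = 2`: `f_E(0) · #E(ℚ)(2)² = e · 2^{ord₂ ∏_ℓ c_ℓ + 1} · #Sel_{2^∞}(E/ℚ)`, `e ∈ ℤ₂ ∖ {0}`, FOR EVERY GLOBALLY MINIMAL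
ELLIPTIC `W/ℚ` NON-SPLIT MULTIPLICATIVE AT `2` — rational `2`-torsion ALLOWED.** Equivalently
`ord₂ f_E(0) + 2·ord₂ #E(ℚ)(2) ≥ ord₂ ∏_ℓ c_ℓ + 1 + ord₂ #Sel_{2^∞}(E/ℚ)`: the «upper-half» direction of Greenberg's display
(analogue of Thm. 4.1 with `l_2 = 2`), `X5.O1.TwoAdicEulerCharRankZeroNonsplitMult W 0` being the two-sided (unit) version. Part 4
(`constantCoeff_mul_sq_eq_two_nonsplit_of_defect`) with the receptacle of part 5; `S`, `v₀` from `exists_finset_place`. The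
unit version needs Lemma 4.6^Γ and is NOT claimed. [cite: GreenbergLNM1716, Thm. 4.1 (p. 102), §4 pp. 104–108, 112–113, Prop. 4.13 (p. 122)] -/
theorem constantCoeff_mul_sq_eq_two_nonsplit (W : WeierstrassCurve ℚ) [W.IsGloballyMinimal] [W.IsElliptic]
    (hmult : W.HasMultiplicativeReductionAtPrime 2) (hns : ¬ W.HasSplitMultiplicativeReductionAtPrime 2)
    (κ : ZpExtension ℚ 2) (hκ : κ.IsCyclotomic) {γ : absoluteGaloisGroup ℚ} (hγ : κ.IsTopGenerator γ)
    (D : W.SelmerDualData κ γ) [Finite (W.selmerGroupPInfty 2)]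
    (f : IwasawaAlgebra 2) (hf : Module.charIdeal (IwasawaAlgebra 2) D.X = Ideal.span {f}) :
    Module.Finite (IwasawaAlgebra 2) D.X ∧ Module.IsTorsion (IwasawaAlgebra 2) D.X ∧
      ∃ e : ℤ_[2], e ≠ 0 ∧ PowerSeries.constantCoeff f *
          (Nat.card (AddCommGroup.primaryComponent W.toAffine.Point 2) : ℤ_[2]) ^ 2 =
        e * (2 ^ (padicValNat 2 W.tamagawaProduct + 1) : ℕ) * Nat.card (W.selmerGroupPInfty 2) := by
  classical
  obtain ⟨S, v₀, hS, hv₀⟩ := exists_finset_place W 2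
  let Pv := discreteH1 (localSubgroup (⊤ : Subgroup (absoluteGaloisGroup ℚ)) (v₀.adicCompletion ℚ))
    (localPoints W (v₀.adicCompletion ℚ))
  let P₀ : AddSubgroup Pv := AddCommGroup.primaryComponent Pv 2
  let L : AddSubgroup Pv := AddSubgroup.map (W.localResOver 2 ⊤ (v₀.adicCompletion ℚ))
    (unramifiedOutside (⊤ : Subgroup (absoluteGaloisGroup ℚ)) (W.geomPrimaryTorsion 2) 2
        ((↑S : Set (HeightOneSpectrum (𝓞 ℚ))) ∪ {v₀}) ⊓
      (⨅ v ∈ S, W.localKerOver 2 ⊤ (v.adicCompletion ℚ)) ⊓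
      (⨅ w : InfinitePlace ℚ, W.localKerOver 2 ⊤ w.Completion))
  obtain ⟨hfin, hC⟩ := finite_and_natCard_cokernel_le W 2 S hS v₀ hv₀
  haveI : Finite (P₀ ⧸ L.addSubgroupOf P₀) := hfin
  have hdec : (fun a b : ℚ => Classical.propDecidable (a = b)) = instDecidableEqRat := Subsingleton.elim _ _
  rw [hdec] at hC
  exact constantCoeff_mul_sq_eq_two_nonsplit_of_defect W hmult hns κ hκ hγ D S hS v₀ hv₀
    (QuotientAddGroup.mk' (L.addSubgroupOf P₀)) (fun z ↦ by
      rw [QuotientAddGroup.mk'_apply, QuotientAddGroup.eq_zero_iff, AddSubgroup.mem_addSubgroupOf]) hC f hf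

end Summit.BirchSwinnertonDyer.BirchSwinnertonDyer.Theorems.TorsionEulerChar

end
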